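import Summits.AtomisticToContinuum.Crystallization.Theorems.PalmUnimodularRigidityLayeredLawsSelectHcpCertificateDefs
import Mathlib.Algebra.BigOperators.Finprod

/-!
# Crux `LayeredLawsSelectHcp` (stmt-AtomisticToContinuum-9226), line `mtp-prestress-split-ergodic-frame`:
# the SENT mass of the corrector transport function regroups to the plain chart sum

Registered sub-goal `tube_corrector_sent_identity` of the crux item (lead c2 reshape; certificate calculus, zero mean of
directed correctors).  In the Mecke argument the transport function sent from the root to the atom `y` is
`g y = ∑ᶠ_{X rooted chart, X c = y} φ (reRoot X c)`; its total sent mass `∑ᶠ_{y ∈ S} g y` is the plain sum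
`∑ᶠ_{X rooted chart} φ (reRoot X c)`, because the fibres `{X | IsRootedChart S X ∧ X c = y}`, `y ∈ S`, partition the
(finite, by hypothesis) set of rooted charts: they are disjoint for distinct `y`, and every chart `X` lies in the fibre of
`y = X c ∈ S` (second clause of `IsRootedChart`).  Pure finsum bookkeeping: the outer index set `S` may be infinite, so the
outer sum is first shrunk to the finite image `{X c | X rooted chart}` (outside it the fibre is empty), then
`Finset.sum_fiberwise_of_maps_to`. [folklore]
-/

noncomputable section

namespace Summit.AtomisticToContinuum.Crystallization.Theorems.PalmUnimodularRigidity.LayeredLawsSelectHcp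

open MeasureTheory Set
open Literature.MathematicalPhysics.StatisticalMechanics Literature.Geometry.DiscreteGeometry

/-- **Sent mass of the corrector transport function** (registered sub-goal of stmt-AtomisticToContinuum-9226): for a point
set `S` with finitely many rooted labelled charts, summing `φ (reRoot X c)` over the charts fibrewise — first over the charts
`X` with `X c = y`, then over `y ∈ S` — gives the plain sum over all rooted charts (each chart is counted exactly once, at
`y = X c ∈ S`). [folklore] -/
theorem tube_corrector_sent_identity : ∀ S : Set (EuclideanSpace ℝ (Fin 3)), {X : ℤ × ℤ × ℤ → EuclideanSpace ℝ (Fin 3) | IsRootedChart S X}.Finite → ∀ (φ : (ℤ × ℤ × ℤ → EuclideanSpace ℝ (Fin 3)) → ℝ) (c : ℤ × ℤ × ℤ), ∑ᶠ y ∈ S, ∑ᶠ X ∈ {X : ℤ × ℤ × ℤ → EuclideanSpace ℝ (Fin 3) | IsRootedChart S X ∧ X c = y}, φ (reRoot X c) = ∑ᶠ X ∈ {X : ℤ × ℤ × ℤ → EuclideanSpace ℝ (Fin 3) | IsRootedChart S X}, φ (reRoot X c) := by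
  intro S hF φ c
  classical
  -- each fibre sum is a `Finset` sum over the fibre of the finite chart set
  have hinner : ∀ y ∈ S,
      ∑ᶠ X ∈ {X : ℤ × ℤ × ℤ → EuclideanSpace ℝ (Fin 3) | IsRootedChart S X ∧ X c = y}, φ (reRoot X c) =
        ∑ X ∈ hF.toFinset with X c = y, φ (reRoot X c) := by
    intro y _
    rw [← finsum_mem_coe_finset]
    refine finsum_mem_congr ?_ fun _ _ => rfl
    ext X
    simp only [mem_setOf_eq, Finset.coe_filter, Finite.mem_toFinset]
  rw [finsum_mem_congr rfl hinner]
  -- the outer sum lives on the finite image `{X c | X rooted chart} ⊆ S`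
  have hmaps : ∀ X ∈ hF.toFinset, X c ∈ hF.toFinset.image fun X => X c :=
    fun X hX => Finset.mem_image_of_mem _ hX
  rw [finsum_mem_eq_sum_of_subset _ (t := hF.toFinset.image fun X => X c),
    Finset.sum_fiberwise_of_maps_to hmaps, finsum_mem_eq_finite_toFinset_sum _ hF]
  · rintro y ⟨-, hy⟩
    exact Finset.support_of_fiberwise_sum_subset_image hF.toFinset (fun X => φ (reRoot X c)) (fun X => X c) hy
  · intro y hy
    obtain ⟨X, hX, rfl⟩ := Finset.mem_image.mp (Finset.mem_coe.mp hy)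
    exact ((Finite.mem_toFinset hF).mp hX).2.1 c

end Summit.AtomisticToContinuum.Crystallization.Theorems.PalmUnimodularRigidity.LayeredLawsSelectHcp

end
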